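/-
Copyright: width seat `ym-line-sll-p4` (prover-ym-line-sll-p4-g0-0), route `SoftLoopLongLag`, crux `SoftLoopLagFloorToTorus`
(stmt-QuantumFields-22504), line `birth` — G-free brick for the inner-box engine statements E2 (`stub_innerDatumMeanSmoothG`,
this seat) and E1a/E1b (siblings) of the lead's E-architecture (T′ card v5, `Cruxes/ColdBoxSoftLoopLagFloor/Lines/birth.md`).
-/
import Summits.QuantumFields.YangMills.Theorems.SoftLoopLongLagColdBoxSoftLoopLagFloorStubGaussCore
import Summits.QuantumFields.YangMills.Theorems.WeakCouplingRatesBulkDominatesColdBoxWDirKernelDiagFlat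

/-!
# Route `SoftLoopLongLag`, crux K′ `SoftLoopLagFloorToTorus` (stmt-QuantumFields-22504), line `birth`: the DIRICHLET mutual
# inductance of two `R×R` squares near the centre of the cold box `{0,…,2H}⁴` is the free `ℤ⁴` one up to `K·R⁴/H⁴`, hence
# translation-flat there (G-free)

The one-scale engine of the sibling route `ColdBoxAllGroups` (and the E-architecture of this route's lead, cards
`Cruxes/ColdBoxSoftLoopLagFloor/Lines/birth.md` v5 / `Cruxes/SoftLoopLagFloorToTorus/Lines/birth.md` v3) linearises the box kernel
`boxKernelG ρ β H ζ` of the cube `{0,…,2H}⁴` around the background of the datum; the fluctuation is the temporal-gauge Dirichlet lattice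
Maxwell Gaussian `boxDirichlet H` (D1′), whose plaquette kernel is `boxDirProjKernel H p q` (`Theorems/WeakCouplingRatesDefs.lean`).  For the
soft LOOP observable of this route the Gaussian objects are surface sums of that kernel over the spanning surfaces `rectSurface x R R` of
the `R×R` squares (`Theorems/SoftLoopLongLagDefs.lean`): the **Dirichlet mutual inductance**
`M_D(x, y) = Σ_{p ∈ S(x)} Σ_{q ∈ S(y)} boxDirProjKernel H p q` (written out, no new definition), whose free `ℤ⁴` counterpart is the route's
`mutualInductance x y R = Σ Σ curvatureTwoPoint p q`.

* `exists_abs_dirInductance_sub_mutualInductance_le` — **`|M_D(x,y) − M(x,y)| ≤ K·R⁴/H⁴`** for `H ≥ 32` whenever both surfaces are based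
  within sup-distance `H/8` of the centre `boxCentre H`: termwise the landed Dirichlet-vs-`ℤ⁴` comparison
  `exists_boxDirProjKernel_sub_curl_bound` (`|boxDirProjKernel H p q − (d₁ div₂ g_q)(p)| ≤ K/H⁴`, seat `ym-spine-20043-p1`) and
  `curvatureTwoPoint_eq_curl_greenTensor`, summed over `≤ R² × R²` pairs.  This is item (iii) «`M_D − M_∞` = harmonic correction» of the
  T′ card's S2 map, in absolute form.
* `mutualInductance_shift` — `M(x+v, y+v) = M(x, y)` (stationarity of `curvatureTwoPoint`).
* `exists_abs_dirInductance_shift_sub_le` — hence **`M_D` is translation-flat near the centre**: `|M_D(x+v, y+v) − M_D(x, y)| ≤ 2K·R⁴/H⁴`;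
  with `y = x` this is the loop analogue N1′-loops of the landed `dirKernelDiagFlat` (flatness of the Dirichlet loop-flux VARIANCE
  `V_D(x) = M_D(x,x)` under time translation), the G-free input of the E2 reduction (inner datum mean smoothness of the loop sum ⇐ loop
  mean expansion ∧ flat `V_D` ∧ background drift).
* `norm_fst_sub_le_of_mem_rectSurface`, `rectSurface_near_centre` — the surface of the square at `x` stays within `‖x − c‖ + R` of `c`.

G-free, β-free; no new definition; standard axioms.  HONEST LABEL: rung R2xi-G RECORD label (leaf `WeakCouplingRates.XiPow`, an UPPER bound on
the lattice mass gap); NOT the Clay mass gap; no summit statement is touched.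

References: C. Garban, A. Sepúlveda, IMRN 2023, §2.3.3 (gradient spin-wave kernel on 2-forms); S. Chatterjee, arXiv:1602.01222 §13
(finite-volume lattice Maxwell Gaussians); G. Lawler, V. Limic, *Random Walk: A Modern Introduction* (2010) §6.3 (interior harmonic estimates).
-/

set_option autoImplicit false

noncomputable section

open Finset
open Literature.Probability.LatticeModels (Site)
open Literature.MathematicalPhysics.QuantumLattice (ZdPlaquette)
open Literature.MathematicalPhysics.QuantumFieldTheory
open Literature.MathematicalPhysics.QuantumFieldTheory.LatticeMaxwell
open Literature.MathematicalPhysics.QuantumFieldTheory.AxialGauge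
open Literature.MathematicalPhysics.QuantumFieldTheory.LatticeChain
open Literature.MathematicalPhysics.QuantumFieldTheory.LatticeForm (d₁)
open Summit.QuantumFields.YangMills.Theorems.WeakCouplingRates

namespace Summit.QuantumFields.YangMills.Theorems.SoftLoopLongLag

/-! ## Geometry of the spanning surface -/

/-- A base point of the spanning surface `rectSurface x R T` is `x + a e₁ + b e₂` with `a < R`, `b < T`, hence within sup-distance
`max R T` of `x`: `‖p.1 − c‖ ≤ ‖x − c‖ + max R T` for every centre `c`. -/
theorem norm_fst_sub_le_of_mem_rectSurface {x : Site 4} {R T : ℕ} {p : ZdPlaquette 4} (hp : p ∈ rectSurface x R T)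
    (c : Site 4) : ‖p.1 - c‖ ≤ ‖x - c‖ + max (R : ℝ) (T : ℝ) := by
  unfold rectSurface at hp
  simp only [mem_image, mem_product, mem_range] at hp
  obtain ⟨⟨a, b⟩, ⟨ha, hb⟩, rfl⟩ := hp
  simp only
  have hsplit : x + Pi.single 1 (a : ℤ) + Pi.single 2 (b : ℤ) - c = (x - c) + (Pi.single 1 (a : ℤ) + Pi.single 2 (b : ℤ)) := by
    funext m; simp only [Pi.add_apply, Pi.sub_apply]; ring
  rw [hsplit]
  have htri := norm_add_le (x - c) (Pi.single 1 (a : ℤ) + Pi.single 2 (b : ℤ) : Site 4)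
  suffices hsingle : ‖(Pi.single 1 (a : ℤ) + Pi.single 2 (b : ℤ) : Site 4)‖ ≤ max (R : ℝ) (T : ℝ) by linarith
  refine (pi_norm_le_iff_of_nonneg (by positivity)).2 fun m => ?_
  simp only [Pi.add_apply, Pi.single_apply]
  have ha' : ((a : ℤ) : ℝ) ≤ max (R : ℝ) (T : ℝ) := by
    have : (a : ℝ) ≤ R := by exact_mod_cast ha.le
    exact (le_max_left _ _).trans' (by exact_mod_cast this)
  have hb' : ((b : ℤ) : ℝ) ≤ max (R : ℝ) (T : ℝ) := by
    have : (b : ℝ) ≤ T := by exact_mod_cast hb.le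
    exact (le_max_right _ _).trans' (by exact_mod_cast this)
  split_ifs with h1 h2 h2
  · exact absurd (h1.symm.trans h2) (by decide)
  · simpa only [add_zero, Int.norm_eq_abs, Int.cast_natCast, Nat.abs_cast] using ha'
  · simpa only [zero_add, Int.norm_eq_abs, Int.cast_natCast, Nat.abs_cast] using hb'
  · simp only [add_zero, norm_zero]; positivity

/-- If `‖x − c‖ + R ≤ H/8` then every plaquette of the spanning surface of the `R×R` square at `x` is based within `H/8` of `c`. -/
theorem rectSurface_near_centre {x c : Site 4} {R : ℕ} {H : ℝ} (hx : ‖x - c‖ + R ≤ H / 8) :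
    ∀ p ∈ rectSurface x R R, ‖p.1 - c‖ ≤ H / 8 := fun p hp =>
  ((norm_fst_sub_le_of_mem_rectSurface hp c).trans (by rw [max_self])).trans hx

/-- The spanning surface of the `R×T` rectangle has at most `R·T` plaquettes. -/
theorem card_rectSurface_le (x : Site 4) (R T : ℕ) : (rectSurface x R T).card ≤ R * T := by
  unfold rectSurface
  exact card_image_le.trans (by rw [card_product, card_range, card_range])

/-! ## Dirichlet vs free mutual inductance near the centre -/

/-- The free mutual inductance written with the `ℤ⁴` curl kernel `(d₁ div₂ g_q)(p)` of the box machinery. -/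
theorem mutualInductance_eq_sum_curl_greenTensor (x y : Site 4) (R : ℕ) :
    mutualInductance x y R = ∑ p ∈ rectSurface x R R, ∑ q ∈ rectSurface y R R,
      d₁ (div₂ (greenTensor ((q.1, q.2.1.1, q.2.1.2) : Plaq 4))) p.1 p.2.1.1 p.2.1.2 := by
  unfold mutualInductance
  exact sum_congr rfl fun p _ => sum_congr rfl fun q _ => curvatureTwoPoint_eq_curl_greenTensor p q

/-- **Dirichlet vs free mutual inductance of two `R×R` squares near the centre of the cold box** (G-free): with the constant `K` of
`exists_boxDirProjKernel_sub_curl_bound`, for `H ≥ 32` and squares whose spanning surfaces are based within sup-distance `H/8` of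
`boxCentre H`, `|Σ_{p∈S(x)} Σ_{q∈S(y)} boxDirProjKernel H p q − mutualInductance x y R| ≤ K·R⁴/H⁴`. [folklore] -/
theorem exists_abs_dirInductance_sub_mutualInductance_le :
    ∃ K : ℝ, 0 ≤ K ∧ ∀ (H : ℕ), (32 : ℝ) ≤ H → ∀ (x y : Site 4) (R : ℕ),
      (∀ p ∈ rectSurface x R R, ‖p.1 - boxCentre H‖ ≤ (H : ℝ) / 8) →
      (∀ q ∈ rectSurface y R R, ‖q.1 - boxCentre H‖ ≤ (H : ℝ) / 8) →
      |(∑ p ∈ rectSurface x R R, ∑ q ∈ rectSurface y R R,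
          boxDirProjKernel H ((p.1, p.2.1.1, p.2.1.2) : Plaq 4) ((q.1, q.2.1.1, q.2.1.2) : Plaq 4)) -
        mutualInductance x y R| ≤ K * (R : ℝ) ^ 4 / (H : ℝ) ^ 4 := by
  obtain ⟨K, hK0, hK⟩ := exists_boxDirProjKernel_sub_curl_bound
  refine ⟨K, hK0, fun H hH x y R hx hy => ?_⟩
  have hH0 : (0 : ℝ) < H := by linarith
  rw [mutualInductance_eq_sum_curl_greenTensor, ← sum_sub_distrib]
  simp_rw [← sum_sub_distrib]
  have hterm : ∀ p ∈ rectSurface x R R, ∀ q ∈ rectSurface y R R,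
      |boxDirProjKernel H ((p.1, p.2.1.1, p.2.1.2) : Plaq 4) ((q.1, q.2.1.1, q.2.1.2) : Plaq 4) -
          d₁ (div₂ (greenTensor ((q.1, q.2.1.1, q.2.1.2) : Plaq 4))) p.1 p.2.1.1 p.2.1.2| ≤ K / (H : ℝ) ^ 4 :=
    fun p hp q hq => hK H hH ((p.1, p.2.1.1, p.2.1.2) : Plaq 4) ((q.1, q.2.1.1, q.2.1.2) : Plaq 4) p.2.2 q.2.2 (hx p hp) (hy q hq)
  have hinner : ∀ p ∈ rectSurface x R R,
      |∑ q ∈ rectSurface y R R, (boxDirProjKernel H ((p.1, p.2.1.1, p.2.1.2) : Plaq 4) ((q.1, q.2.1.1, q.2.1.2) : Plaq 4) -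
          d₁ (div₂ (greenTensor ((q.1, q.2.1.1, q.2.1.2) : Plaq 4))) p.1 p.2.1.1 p.2.1.2)| ≤ (R : ℝ) ^ 2 * (K / (H : ℝ) ^ 4) := by
    intro p hp
    refine (abs_sum_le_sum_abs _ _).trans ((sum_le_card_nsmul _ _ _ (hterm p hp)).trans ?_)
    rw [nsmul_eq_mul]
    refine mul_le_mul_of_nonneg_right ?_ (by positivity)
    have := card_rectSurface_le y R R
    calc ((rectSurface y R R).card : ℝ) ≤ ((R * R : ℕ) : ℝ) := by exact_mod_cast this
      _ = (R : ℝ) ^ 2 := by push_cast; ring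
  refine (abs_sum_le_sum_abs _ _).trans ((sum_le_card_nsmul _ _ _ hinner).trans ?_)
  rw [nsmul_eq_mul]
  have hcard : ((rectSurface x R R).card : ℝ) ≤ (R : ℝ) ^ 2 := by
    have := card_rectSurface_le x R R
    calc ((rectSurface x R R).card : ℝ) ≤ ((R * R : ℕ) : ℝ) := by exact_mod_cast this
      _ = (R : ℝ) ^ 2 := by push_cast; ring
  calc ((rectSurface x R R).card : ℝ) * ((R : ℝ) ^ 2 * (K / (H : ℝ) ^ 4))
      ≤ (R : ℝ) ^ 2 * ((R : ℝ) ^ 2 * (K / (H : ℝ) ^ 4)) := mul_le_mul_of_nonneg_right hcard (by positivity)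
    _ = K * (R : ℝ) ^ 4 / (H : ℝ) ^ 4 := by ring

/-! ## Translation flatness -/

/-- Sums over the translated surface `rectSurface (x + v) R T` are sums over `rectSurface x R T` with translated plaquettes. -/
theorem sum_rectSurface_shift (x v : Site 4) (R T : ℕ) (f : ZdPlaquette 4 → ℝ) :
    ∑ p ∈ rectSurface (x + v) R T, f p = ∑ p ∈ rectSurface x R T, f (p.1 + v, p.2) := by
  rw [sum_rectSurface_eq, sum_rectSurface_eq]
  refine sum_congr rfl fun a _ => sum_congr rfl fun b _ => ?_
  have hpt : x + v + Pi.single 1 (a : ℤ) + Pi.single 2 (b : ℤ) = x + Pi.single 1 (a : ℤ) + Pi.single 2 (b : ℤ) + v := by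
    funext m; simp only [Pi.add_apply]; ring
  rw [hpt]

/-- **Stationarity of the free mutual inductance**: `mutualInductance (x + v) (y + v) R = mutualInductance x y R`. [folklore] -/
theorem mutualInductance_shift (x y v : Site 4) (R : ℕ) :
    mutualInductance (x + v) (y + v) R = mutualInductance x y R := by
  unfold mutualInductance
  rw [sum_rectSurface_shift]
  refine sum_congr rfl fun p _ => ?_
  rw [sum_rectSurface_shift]
  exact sum_congr rfl fun q _ => curvatureTwoPoint_shift p q v

/-- **The Dirichlet mutual inductance is translation-flat near the centre** (G-free; N1′-loops when `y = x`): with the constant `K`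
of `exists_boxDirProjKernel_sub_curl_bound`, for `H ≥ 32`, whenever the four spanning surfaces `S(x)`, `S(y)`, `S(x+v)`, `S(y+v)` are based
within sup-distance `H/8` of `boxCentre H`,
`|Σ_{S(x+v)×S(y+v)} boxDirProjKernel H − Σ_{S(x)×S(y)} boxDirProjKernel H| ≤ 2K·R⁴/H⁴`. [folklore] -/
theorem exists_abs_dirInductance_shift_sub_le :
    ∃ K : ℝ, 0 ≤ K ∧ ∀ (H : ℕ), (32 : ℝ) ≤ H → ∀ (x y v : Site 4) (R : ℕ),
      (∀ p ∈ rectSurface x R R, ‖p.1 - boxCentre H‖ ≤ (H : ℝ) / 8) →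
      (∀ q ∈ rectSurface y R R, ‖q.1 - boxCentre H‖ ≤ (H : ℝ) / 8) →
      (∀ p ∈ rectSurface (x + v) R R, ‖p.1 - boxCentre H‖ ≤ (H : ℝ) / 8) →
      (∀ q ∈ rectSurface (y + v) R R, ‖q.1 - boxCentre H‖ ≤ (H : ℝ) / 8) →
      |(∑ p ∈ rectSurface (x + v) R R, ∑ q ∈ rectSurface (y + v) R R,
          boxDirProjKernel H ((p.1, p.2.1.1, p.2.1.2) : Plaq 4) ((q.1, q.2.1.1, q.2.1.2) : Plaq 4)) -
        (∑ p ∈ rectSurface x R R, ∑ q ∈ rectSurface y R R,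
          boxDirProjKernel H ((p.1, p.2.1.1, p.2.1.2) : Plaq 4) ((q.1, q.2.1.1, q.2.1.2) : Plaq 4))|
        ≤ 2 * K * (R : ℝ) ^ 4 / (H : ℝ) ^ 4 := by
  obtain ⟨K, hK0, hK⟩ := exists_abs_dirInductance_sub_mutualInductance_le
  refine ⟨K, hK0, fun H hH x y v R hx hy hxv hyv => ?_⟩
  have h1 := hK H hH (x + v) (y + v) R hxv hyv
  have h2 := hK H hH x y R hx hy
  rw [mutualInductance_shift] at h1
  rw [abs_sub_comm] at h2
  refine ((abs_sub_le _ (mutualInductance x y R) _).trans (add_le_add h1 h2)).trans (le_of_eq ?_)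
  ring

end Summit.QuantumFields.YangMills.Theorems.SoftLoopLongLag

end
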